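import Summits.QuantumFields.YangMills.Theorems.BalabanLadderIROddTorusLargeFieldRaritySharp
import Literature.MathematicalPhysics.QuantumLattice.LatticeGaugeDLRFreeEnergyProofs
import Literature.MathematicalPhysics.QuantumFieldTheory.WilsonPlaquetteChessboardTail
import Literature.MathematicalPhysics.QuantumFieldTheory.YangMillsOS
import HarnessLib

/-!
# Line 4 `largefield-rarity-chessboard` — the shared supplier (R) «large-field rarity, Peierls-multiplicative, uniform in β and
# the volume» PROVED on the odd tori of the crux (LINE 3 `Lines/smallfield_polymer_coder.lean`, stub `stub_largeFieldRarity`;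
# NT rows (R)/(B4)) — crux `BalabanLadder.IR` (stmt-QuantumFields-19354), ideator `ym-ir-idea-4` g3 (lens: certified interpolation
# cluster-region → small-field region; here the LARGE-field region is priced against the small-field FREE ENERGY by reflection
# positivity, and the price is made β-uniform by the Gaussian free-energy asymptotics the tree already proves)

Landed for item `stmt-QuantumFields-19354` (`--supports … --as helper`) by the LEAD prover ab-p1 under director-ym RULING g9-№2 ∕ №14 (3)
(critic ym-ir-crit-1 GATE 2026-08-28T03:18:39Z: supplier PROVED, land under `Theorems/IR/`); authored by ideator ym-ir-idea-4 g3, split of the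
sorry-free workfile `Cruxes/IR/Lines/largefield_rarity_chessboard.lean` v8 per `Cruxes/IR/Lines/largefield_rarity_chessboard_LANDING.md`
(five files: `LargeFieldRarityDefs` → {`…FiniteSize`, `…Increment`} → `…Engine` → `…OddTori`).
This file: §1 the plaquette cost `plaqCost`, the explicit volume floor `volFloor β = (⌈β⌉₊+2)²`, and EVERY typed statement of the package
((FE)∕(FE∞)∕(FS)∕(EM)∕(CB)∕(R-even)∕(R-odd-literal)∕(CZ)∕(R-on-𝓛)∕(R-odd-tori)∕(R♭ From)∕(FE<)∕(R all odd tori)∕(R<)); NO theorems.  The package docstring follows.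

MAIN THEOREM (sorry-free; `largeFieldRarity_oddSides`; named statement `LargeFieldRarityOddTori`, witness `largeFieldRarityOddTori_holds`).  For every compact simple Lie
group `G` and lattice representation `r` there are `c > 0`, `A₀`, `β₃` such that for all `A ≥ A₀`, `β ≥ β₃`, every ODD
torus side `L ≥ 3` above the EXPLICIT volume floor `L ≥ volFloor β = (⌈β⌉₊+2)²` and EVERY plaquette family `Q ⊆ 𝕋⁴_L`:
    `μ_{L,β}{U | ∀ p ∈ Q, s_p(U) > A/(2β)} ≤ exp(−c·A·#Q)`,   `s_p = N − Re tr ρ(U_p)` (the Wilson plaquette cost).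
The threshold `A/(2β)` is FIXED in units of `1/β` (no `log β`), the rate `c` and the onset `A₀` do not depend on `β`, `L` or `Q`.
This is the typed content of (R) «large-field rarity, Peierls-multiplicative, uniform in β and the volume» at the sides the
literal crux quantifies over (`2S+1`, `S ≥ 1`), up to the re-typing recorded under CONSUMERS.

ENGINE (every seam proved in this file; external inputs are TREE THEOREMS, cited by name):
* (CZ on 𝓛) `ChessboardZRatio 𝓛` «chessboard-to-free-energy for EXPONENTIAL plaquette functionals»:
  `⟨∏_{p∈Q} e^{λβ s_p}⟩_{L,β} ≤ exp((log Z_L((1−kλ)β) − log Z_L(β))·#Q/(kL⁴))`.  ODD sides `≥ 3`: `chessboardZRatio_odd` — it IS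
  the tree's odd-torus chessboard `OddTorusChessboard.wilsonExpectation_expObs_le_exp_card_all` (seat ym-infvol-p3, 2026-08-27:
  mixed site∕link reflections of the odd torus after Borgs–Seiler, Hölder over the `k = #Orient 4` orientations;
  Fröhlich–Israel–Lieb–Simon CMP 62 (1978) Thm 4.1).
* (FE∞) `FreeEnergyThermo`: `|f_r(β) + ν log β − K| ≤ 1` for `β ≥ β₃` — `freeEnergyThermo`, from the tree's kernel-checked
  CHATTERJEE THEOREM FOR EVERY COMPACT SIMPLE `G`, `Summit.QuantumFields.YangMills.Theorems.freeEnergyLogCoefficient_proof`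
  (crux `FreeEnergyLogCoefficient` of route `EquipartitionCriticality`, stmt-QuantumFields-8759, closed·proved @ c63cf0bd22ae):
  `f_r(β) + (3D/2)·log β → K_r`, `D = dim G` (S. Chatterjee, JFA 2016, Thm 2.1 for `U(N)` [corpus: paper:arxiv-1602.01222 p.4]).
* (FS) `FiniteSizeFreeEnergy`: `|log Z_L(β) − L⁴ f_r(β)| ≤ C(1+|β|)(L⁴/m + L³m)` — `finiteSizeFreeEnergy`, from the tree's sub-box
  estimate `FreeEnergy.abs_torusLogPartition_sub_le` (Friedli–Velenik Thm 3.6 pattern) used twice (at `(L,m)` and along `L' → ∞`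
  against `HasFreeEnergyDensity` ∕ `FreeEnergy.tendsto_div_floor`), the box bounds `FreeEnergy.zdZ_le` ∕ `pow_le_zdZ`, and the
  abstract real lemma `abs_sub_limit_le_of_subbox`.
* (FE) `FreeEnergyIncrement`: `log Z_L(β') − log Z_L(β) ≤ ν₀L⁴log(β/β') + CL⁴` for `β₃ ≤ β' ≤ β`, `L ≥ L₀(β) = (⌈β⌉+2)²` —
  `freeEnergyIncrement_of_thermo : (FE∞) → (FS) → (FE)` (take `m = ⌈β⌉+2` in (FS): the `(1+β)·L⁴/m` error is `O(L⁴)`).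
* `expMomentBound_of_increment : (FE) → (EM)`, `largeFieldRarityOn_of_ZRatio : (CZ on 𝓛) → (FE) → (R on 𝓛)` (exponential
  Chebyshev on `Q` FIRST, then the chessboard, then (FE) at `β' = (1−kθ)β`: the `log β`'s of numerator and denominator CANCEL;
  `c = θ/4`, `A₀ = 4C₁/θ`), `largeFieldRarityEven_of : (CB) → (EM) → (R-even)` for even sides given an indicator chessboard (CB)
  (`ChessboardEvents`, hypothesis — not needed for the crux's odd tori and NOT stubbed: this file has no `sorry`).

WHY THIS IS THE LINE (and what is new).  The tree's odd-torus Peierls–chessboard rarity (`OddTorusChessboard.measureReal_forall_le_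
cellAction_le_pow_rep_sharp`, 2026-08-27) has rate `exp(−λT/m + n(K₀ + D₁ log β)/m)` per cell: its free-energy input is
`Δ_L(λ)/L⁴ ≤ K₀ + D₁ log β` (`torusLogPartition_sub_le_rep` = crude Gaussian lower bound + `log Z ≤ 0`), so at the FIXED threshold
`T = A/(2β)`, `λ = θβ` the base is `e^{−θA/2 + K₀ + D₁ log β} → ∞`: contentful only for thresholds `≳ (log β)/β` (equally: tree
`WilsonPlaquetteTail.measureReal_plaquette_mem_le`, card `Ideas/odd-chessboard-block-rarity.md` §3).  LINE 3's coder architecture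
(fixed `λ` small-field scale `2^λ`, defects = plaquettes with `s_p > A/(2β)`, `A` FIXED) and NT's (R) need the base `e^{−cA}`
UNIFORMLY in `β` — which after the chessboard is EXACTLY a two-sided free-energy increment bound with `O(L⁴)` error, and THAT is
what the tree's Chatterjee theorem (route `EquipartitionCriticality`, dormant) delivers once moved from the thermodynamic limit back
to finite tori by (FS).  The lever: Chatterjee-class free-energy asymptotics as the β-UNIFORMISER of FILS chessboard rarity — a
junction of two routes (`EquipartitionCriticality.FreeEnergyLogCoefficient` ↔ `BalabanLadder.IR`'s supplier (R)) that nobody had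
drawn; free energies do not see the infrared problem (no clustering input, no expansion), so (R) leaves the list of IR-hard
suppliers on the crux's odd tori.  It does NOT touch the IR-hard core (T)/(M-b) of LINE 3 ∕ NT.

RELATION TO `Lines/largefield_rarity_uniform.lean` (ym-ir-idea-5 g6, published 2026-08-28T02:43Z — FIRST; this file was
checked sorry-free at 02:49Z, independently).  SAME LEVER (odd-torus chessboard × the tree's Chatterjee theorem; the `log β`'s
cancel), found by two seats within minutes; idea-5's priority on the lever is acknowledged and its statement `LargeFieldRarityFrom`
is re-proved here (`largeFieldRarityFrom_holds'`).  What THIS file adds: (a) the finite-size THEOREM (FS) `finiteSizeFreeEnergy`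
(`|log Z_L − L⁴f| ≤ C(1+|β|)(L⁴/m + L³m)`), whence an EXPLICIT volume floor `volFloor β = (⌈β⌉₊+2)²` in place of the non-explicit
`S₁(β)` of the pointwise thermodynamic limit (idea-5's «delta 2 … NOT done here», in polynomial form; `(log β)^{1/4}` or no floor
at all remain open: zero-mode bookkeeping on small tori); (b) constants `(c, β₃, floor)` UNIFORM in `A ≥ A₀` (one rate `c = θ/4`);
(c) the increment (FE) for EVERY pair `β₃ ≤ β' ≤ β` (not only doubling) and exponential moments (EM) of `λβ·Σ_{p∈F} s_p` for
arbitrary plaquette families; (d) a parity-agnostic engine `(CZ on 𝓛) → (FE) → (R on 𝓛)` with the even-side output modulo an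
indicator chessboard (CB), for the class-parametric leg.  One statement, two kernel-checked proofs; the consumer-side re-typing
of LINE 3's (R) is done in `Lines/smallfield_polymer_coder.lean` rev 3 (this seat).

BELOW THE FLOOR (§8).  The engine is stated for a GENERAL floor `fl : ℝ → ℕ`; the typed residual (FE<) `FreeEnergyIncrementBelow`
(the increment bound on tori `L < (⌈β⌉₊+2)²`: finite-torus Laplace asymptotics with an `O(L⁴)`-sharp mode count — OPEN, research M)
gives (FE) at floor `0` (`freeEnergyIncrementFrom_zero_of_below`) and hence LINE 3's re-typed (R) on ALL odd tori `≥ 3`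
(`largeFieldRarityAllOddTori_of_below`) and its (R<) (`largeFieldRaritySmallTori_of_below`) BY NAME: the rarity question for
`BalabanLadder.IR`'s (M-c) is reduced to ONE free-energy statement on small tori.

CONSUMERS (honest).  (i) LINE 3's literal `stub_largeFieldRarity` (= `LargeFieldRarityOdd` below: ALL odd tori incl. `S = 0`,
`∀ A > 0 ∃ c`, no volume floor) is NOT literally implied: the theorem gives `∃ A₀ ∀ A ≥ A₀` with one rate `c`, sides `≥ 3`, floor
`L ≥ volFloor β = (⌈β⌉₊+2)²`; all three relaxations are what (M-b)'s Peierls count of SPARSE defects on tori `≥ M₁(β)` consumes — recommended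
re-typing of LINE 3's (R) to `LargeFieldRarityOn {L | Odd L ∧ 3 ≤ L}` (this file's `largeFieldRarity_oddSides` then discharges it),
not applied here (LINE 3 is g2's registered skeleton; critics ∕ g4 decide).  (ii) The even theorem `largeFieldRarity_even (hCB)`
serves the CLASS-PARAMETRIC infrared leg of the route owner's ruling on the torus-parity junction (ym-beyond-p2 g20, 2026-08-26:
currency `GapInUnitsOnSides G r a 𝓣`, `𝓣_A = familySides`, Bałaban's even sides) once an even indicator chessboard is supplied
(tree `WilsonPlaquetteTail.integral_prod_plaquette_le_rpow_sites` by name + axis permutations + Hölder + `ε ↓ 0`).  (iii) NT's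
(R)/(B4) rows of the desk census name the same supplier.  No implication to `BalabanLadder.IR` is claimed.

HONESTY.  Nothing here proves the Clay Yang–Mills mass gap, a lattice mass gap, `BalabanLadder.IR`, (T) or (M-b); R4 of the
ladder closes only the conditional finite-𝕋⁴ rung `BalabanLadder.UV`.  What IS proved (no `sorry` in this file): the β-uniform
fixed-threshold large-field rarity (R) on odd tori `≥ 3`, for every compact simple `G`.
-/

noncomputable section

open MeasureTheory Finset
open Literature.MathematicalPhysics.QuantumFieldTheory Literature.MathematicalPhysics.QuantumLattice
open Summit.QuantumFields.YangMills.Theorems (OddTorusChessboard.Orient OddTorusChessboard.wilsonExpectation_expObs_le_exp_card_all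
  SoloBlind.expObs)

namespace Summit.QuantumFields.YangMills.Cruxes.IR.LargeFieldRarityChessboard

/-! ## §1 The plaquette cost and the typed statements -/

section Defs

variable {G : Type} [Group G]

/-- The Wilson cost `s_p(U) = N − Re tr ρ(U_p) ∈ [0, 2N]` of one plaquette (string-equal to LINE 3's `plaqCost`). -/
def plaqCost {N L : ℕ} (ρ : G →* Matrix (Fin N) (Fin N) ℂ) (U : GaugeConfig 4 L G)
    (p : Literature.MathematicalPhysics.QuantumFieldTheory.Plaquette 4 L) : ℝ :=
  (N : ℝ) - (ρ (plaquetteHolonomy U p.1 p.2.1.1 p.2.1.2)).trace.re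

/-- **The explicit volume floor** `L₀(β) = (⌈β⌉₊ + 2)²`: every bound below holds on tori of side `L ≥ volFloor β`
(the finite-size error of (FS) is `∝ (1+β)·(L⁴/m + L³m)`, made `O(L⁴)` by `m = ⌈β⌉₊ + 2 ≤ √L`). -/
def volFloor (β : ℝ) : ℕ := (⌈β⌉₊ + 2) * (⌈β⌉₊ + 2)

end Defs

/-- **(FE) FREE-ENERGY INCREMENT** (PROVED: `freeEnergyIncrement_of_thermo freeEnergyThermo finiteSizeFreeEnergy`; Chatterjee-class).  For every compact simple `G` and lattice
representation `r` there are `ν₀, C, β₃ > 0` such that for `β₃ ≤ β' ≤ β` and every torus side `L ≥ volFloor β = (⌈β⌉₊+2)²`:  `log Z_L(β') − log Z_L(β) ≤ ν₀ L⁴ log(β/β') + C L⁴`.  (Gaussian heuristic: `Z(β')/Z(β) = ⟨e^{(β−β')S}⟩_β ≈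
(β/β')^{ν/2}`, `ν = dim G·(3L⁴+1)` transverse modes; the content is the UPPER bound on `Z(β')`, i.e. no log-extensive entropy
beyond the Gaussian one — Chatterjee 2016 Thm 2.1 ∕ §17 for `U(N)` boxes, tree `ChatterjeeJointLimit`.) -/
def FreeEnergyIncrementFrom (fl : ℝ → ℕ) : Prop :=
  ∀ (G : Type) [Group G] [TopologicalSpace G] [IsTopologicalGroup G] [CompactSpace G],
    IsCompactSimpleLieGroup G →
    letI : MeasurableSpace G := borel G
    haveI : BorelSpace G := ⟨rfl⟩
    ∀ (r : LatticeRep G), ∃ (ν₀ C β₃ : ℝ), 0 < β₃ ∧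
      ∀ (L : ℕ) [NeZero L] (β' β : ℝ), β₃ ≤ β' → β' ≤ β → fl β ≤ L →
        torusLogPartition 4 r.ρ β' L - torusLogPartition 4 r.ρ β L ≤
          ν₀ * (L : ℝ) ^ 4 * Real.log (β / β') + C * (L : ℝ) ^ 4

/-- (FE) at the explicit floor `volFloor` (PROVED) — every engine theorem below is stated for a GENERAL floor `fl : ℝ → ℕ`, so
that the floor-free case `fl = 0` (all tori; open below the floor, see `FreeEnergyIncrementBelow`) runs through the same engine. -/
def FreeEnergyIncrement : Prop := FreeEnergyIncrementFrom volFloor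

/-- **(FE∞) FREE-ENERGY ASYMPTOTICS IN THE THERMODYNAMIC LIMIT, bound form** — PROVED below (`freeEnergyThermo`) from the
TREE's kernel-checked Chatterjee theorem for EVERY compact simple `G` and faithful unitary lattice representation:
`Summit.QuantumFields.YangMills.Theorems.freeEnergyLogCoefficient_proof` (crux `FreeEnergyLogCoefficient` of route
`EquipartitionCriticality`, stmt-QuantumFields-8759, closed·proved @ c63cf0bd22ae; axioms `propext, Classical.choice, Quot.sound`
only): `f_r(β) + (3D/2) log β → K_r` (`f_r` = the torus free energy per site `freeEnergyDensity 4 r.ρ`, which exists by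
`exists_hasFreeEnergyDensity_holds`).  Bound form: `|f_r(β) + ν log β − K| ≤ 1` for `β ≥ β₃`. -/
def FreeEnergyThermo : Prop :=
  ∀ (G : Type) [Group G] [TopologicalSpace G] [IsTopologicalGroup G] [CompactSpace G],
    IsCompactSimpleLieGroup G →
    letI : MeasurableSpace G := borel G
    haveI : BorelSpace G := ⟨rfl⟩
    ∀ (r : LatticeRep G), ∃ (ν K β₃ : ℝ), 0 < β₃ ∧
      ∀ β : ℝ, β₃ ≤ β → |freeEnergyDensity 4 r.ρ β + ν * Real.log β - K| ≤ 1

/-- **(FS) FINITE-SIZE BOUND for the torus free energy** (PROVED below: `finiteSizeFreeEnergy`): `|log Z_L(β) − L⁴ f_r(β)| ≤ C(1+|β|)(L⁴/m + L³m)` for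
every `2 ≤ m`, `m² ≤ L`.  Route: the tree's sub-box estimate `FreeEnergy.abs_torusLogPartition_sub_le` (Friedli–Velenik Thm 3.6
pattern: `|log Z_L − ⌊L/m⌋⁴ log Z(A_{m−1})| ≤ |β|(N+M)·6·(L⁴ − ⌊L/m⌋⁴(m−1)⁴)`), once at `(L, m)` and once along `L' → ∞`
(`HasFreeEnergyDensity`, `FreeEnergy.tendsto_div_floor`) to price `|log Z(A_{m−1}) − m⁴ f|`, plus `a⁴ − b⁴ ≤ 4a³(a − b)`. -/
def FiniteSizeFreeEnergy : Prop :=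
  ∀ (G : Type) [Group G] [TopologicalSpace G] [IsTopologicalGroup G] [CompactSpace G],
    letI : MeasurableSpace G := borel G
    haveI : BorelSpace G := ⟨rfl⟩
    ∀ (r : LatticeRep G), ∃ C : ℝ, 0 ≤ C ∧ ∀ (β : ℝ) (L m : ℕ) [NeZero L], 2 ≤ m → m * m ≤ L →
      |torusLogPartition 4 r.ρ β L - (L : ℝ) ^ 4 * freeEnergyDensity 4 r.ρ β| ≤
        C * (1 + |β|) * ((L : ℝ) ^ 4 / m + (L : ℝ) ^ 3 * m)

/-- **(EM) EXPONENTIAL-MOMENT BOUND** for the reduced coupling on an arbitrary plaquette family: there is `λ ∈ (0,1)` with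
`⟨∏_{p∈F} e^{λβ s_p}⟩_{L,β} ≤ e^{C L⁴}` for all `F`, `β ≥ β₃`, `L ≥ L₀(β)` (PROVED from (FE): `expMomentBound_of_increment`). -/
def ExpMomentBoundFrom (fl : ℝ → ℕ) : Prop :=
  ∀ (G : Type) [Group G] [TopologicalSpace G] [IsTopologicalGroup G] [CompactSpace G],
    IsCompactSimpleLieGroup G →
    letI : MeasurableSpace G := borel G
    haveI : BorelSpace G := ⟨rfl⟩
    ∀ (r : LatticeRep G), ∃ (lam C β₃ : ℝ), 0 < lam ∧ 0 < β₃ ∧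
      ∀ (L : ℕ) [NeZero L] (β : ℝ), β₃ ≤ β → fl β ≤ L →
        ∀ F : Finset (Literature.MathematicalPhysics.QuantumFieldTheory.Plaquette 4 L),
          ∫ U, ∏ p ∈ F, Real.exp (lam * β * plaqCost r.ρ U p) ∂(wilsonMeasure (d := 4) (L := L) r.ρ β) ≤
            Real.exp (C * (L : ℝ) ^ 4)

/-- (EM) at the explicit floor (PROVED). -/
def ExpMomentBound : Prop := ExpMomentBoundFrom volFloor

/-- **(CB) CHESSBOARD FOR PLAQUETTE EVENTS, ALL ORIENTATIONS, EVEN SIDES** (plumbing, every ingredient in the tree BY NAME: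
`WilsonPlaquetteTail.integral_prod_plaquette_le_rpow_sites` (FILS Thm 4.1 for the orientations `(0,a)`, applied to `𝟙_E + ε`,
`ε ↓ 0` as in `PlaquetteChessboard.integral_plaquette_le_rpow_all`), `wilsonMeasure_map_configPerm` (axis permutations, for
the orientations `(i,j)`, `0 < i`), and `𝟙_{∩_o} ≤ min_o 𝟙_{∩ Q_o} ≤` geometric mean over the six orientations): for a
measurable conjugation- and inversion-invariant `E ⊆ G`, `μ{∀ p ∈ Q, U_p ∈ E} ≤ ∏_o μ{∀ p of orientation o, U_p ∈ E}^{#Q_o/(6L⁴)}`.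
Holds for every compact `G` (no simplicity) and every `β ≥ 0`; `L` even and non-zero (so `L ≥ 2`). -/
def ChessboardEvents : Prop :=
  ∀ (G : Type) [Group G] [TopologicalSpace G] [IsTopologicalGroup G] [CompactSpace G],
    letI : MeasurableSpace G := borel G
    haveI : BorelSpace G := ⟨rfl⟩
    ∀ (r : LatticeRep G) (L : ℕ) [NeZero L], Even L → ∀ (β : ℝ), 0 ≤ β →
      ∀ (E : Set G), MeasurableSet E → (∀ g h : G, h * g * h⁻¹ ∈ E ↔ g ∈ E) → (∀ g : G, g⁻¹ ∈ E ↔ g ∈ E) →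
        ∀ Q : Finset (Literature.MathematicalPhysics.QuantumFieldTheory.Plaquette 4 L),
          (wilsonMeasure (d := 4) (L := L) r.ρ β).real
              {U | ∀ p ∈ Q, plaquetteHolonomy U p.1 p.2.1.1 p.2.1.2 ∈ E} ≤
            ∏ o : {q : Fin 4 × Fin 4 // q.1 < q.2},
              ((wilsonMeasure (d := 4) (L := L) r.ρ β).real
                  {U | ∀ p : Literature.MathematicalPhysics.QuantumFieldTheory.Plaquette 4 L, p.2 = o →
                    plaquetteHolonomy U p.1 p.2.1.1 p.2.1.2 ∈ E}) ^
                (((Q.filter fun p => p.2 = o).card : ℝ) / (6 * (L : ℝ) ^ 4))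

/-- **(R-even) LARGE-FIELD RARITY ON EVEN TORI, Peierls-multiplicative, uniform in `β` and the volume** (the engine's
output; PROVED from (CB)+(EM): `largeFieldRarityEven_of`).  Compared with LINE 3's `LargeFieldRarity`: even sides with a volume
floor `L ≥ L₀(β)` instead of all odd sides, and `∃ A₀ ∀ A ≥ A₀` with ONE rate `c` instead of `∀ A > 0 ∃ c` (the mechanism
certifies large thresholds only, which is what a Peierls count of SPARSE defects consumes). -/
def LargeFieldRarityEvenFrom (fl : ℝ → ℕ) : Prop :=
  ∀ (G : Type) [Group G] [TopologicalSpace G] [IsTopologicalGroup G] [CompactSpace G],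
    IsCompactSimpleLieGroup G →
    letI : MeasurableSpace G := borel G
    haveI : BorelSpace G := ⟨rfl⟩
    ∀ (r : LatticeRep G), ∃ (c A₀ β₃ : ℝ), 0 < c ∧
      ∀ (A : ℝ), A₀ ≤ A → ∀ (β : ℝ), β₃ ≤ β → ∀ (L : ℕ) [NeZero L], Even L → fl β ≤ L →
        ∀ Q : Finset (Literature.MathematicalPhysics.QuantumFieldTheory.Plaquette 4 L),
          wilsonMeasure (d := 4) (L := L) r.ρ β {U | ∀ p ∈ Q, A / (2 * β) < plaqCost r.ρ U p} ≤
            ENNReal.ofReal (Real.exp (-(c * A * Q.card)))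

/-- (R-even) at the explicit floor. -/
def LargeFieldRarityEven : Prop := LargeFieldRarityEvenFrom volFloor

/-- **(R-odd-literal) = LINE 3's `LargeFieldRarity` VERBATIM** (ALL odd tori `2S+1` incl. `S = 0`, `∀ A > 0 ∃ c`, no volume
floor), recorded for comparison only: NOT proved and NOT implied by `LargeFieldRarityOn {L | Odd L ∧ 3 ≤ L}` (which has
`∃ A₀ ∀ A ≥ A₀` and the floor `L ≥ L₀(β)`). -/
def LargeFieldRarityOdd : Prop :=
  ∀ (G : Type) [Group G] [TopologicalSpace G] [IsTopologicalGroup G] [CompactSpace G],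
    IsCompactSimpleLieGroup G →
    letI : MeasurableSpace G := borel G
    haveI : BorelSpace G := ⟨rfl⟩
    ∀ (r : LatticeRep G) (A : ℝ), 0 < A → ∃ (c β₃ : ℝ), 0 < c ∧ ∀ β : ℝ, β₃ ≤ β →
      ∀ (S : ℕ) (Q : Finset (Literature.MathematicalPhysics.QuantumFieldTheory.Plaquette 4 (2 * S + 1))),
        wilsonMeasure (d := 4) (L := 2 * S + 1) r.ρ β
            {U | ∀ p ∈ Q, A / (2 * β) < plaqCost r.ρ U p} ≤
          ENNReal.ofReal (Real.exp (-(c * A * Q.card)))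

/-- **(CZ) CHESSBOARD-TO-FREE-ENERGY for exponential plaquette functionals, sides in `𝓛`** (PARITY-AGNOSTIC typing of the
reflection-positivity input): there are `k ≥ 1 > kθ > 0` such that for every side `L ∈ 𝓛`, every `β ≥ 0`, every `0 < λ ≤ θ` and
every plaquette set `Q`, `⟨∏_{p∈Q} e^{λβ s_p}⟩_{L,β} ≤ (Z_L((1−kλ)β)/Z_L(β))^{#Q/(kL⁴)}`.  ODD `L ≥ 3`: PROVED below
(`chessboardZRatio_odd`, `k = 6`, `θ = 1/12`) from the tree's `OddTorusChessboard.wilsonExpectation_expObs_le_exp_card_all` (mixed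
site|link reflections of the odd torus, Borgs–Seiler CMP 91 (1983) §II.2; Hölder over the six orientations; FILS Thm 4.1).  EVEN
`L`: the same chain with the tree's `WilsonPlaquetteTail.integral_prod_plaquette_le_rpow_sites` on the positive class function
`e^{6λβ s}` and axis permutations `wilsonMeasure_map_configPerm` — not written here (the even output goes through the indicator
variant `ChessboardEvents` instead). -/
def ChessboardZRatio (𝓛 : Set ℕ) : Prop :=
  ∀ (G : Type) [Group G] [TopologicalSpace G] [IsTopologicalGroup G] [CompactSpace G],
    letI : MeasurableSpace G := borel G
    haveI : BorelSpace G := ⟨rfl⟩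
    ∀ (r : LatticeRep G), ∃ (k θ : ℝ), 0 < θ ∧ 1 ≤ k ∧ k * θ < 1 ∧
      ∀ (L : ℕ) [NeZero L], L ∈ 𝓛 → ∀ (β : ℝ), 0 ≤ β → ∀ (lam : ℝ), 0 < lam → lam ≤ θ →
        ∀ Q : Finset (Literature.MathematicalPhysics.QuantumFieldTheory.Plaquette 4 L),
          ∫ U, ∏ p ∈ Q, Real.exp (lam * β * plaqCost r.ρ U p) ∂(wilsonMeasure (d := 4) (L := L) r.ρ β) ≤
            Real.exp ((torusLogPartition 4 r.ρ ((1 - k * lam) * β) L - torusLogPartition 4 r.ρ β L) *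
              ((Q.card : ℝ) / (k * (L : ℝ) ^ 4)))

/-- **(R-on-𝓛) LARGE-FIELD RARITY ON THE SIDES `𝓛`, Peierls-multiplicative, uniform in `β` and the volume** — the
parity-agnostic output (`LargeFieldRarityEven` is the case `𝓛 = 2ℕ`; PROVED from (CZ)+(FE): `largeFieldRarityOn_of_ZRatio`). -/
def LargeFieldRarityOnFrom (𝓛 : Set ℕ) (fl : ℝ → ℕ) : Prop :=
  ∀ (G : Type) [Group G] [TopologicalSpace G] [IsTopologicalGroup G] [CompactSpace G],
    IsCompactSimpleLieGroup G →
    letI : MeasurableSpace G := borel G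
    haveI : BorelSpace G := ⟨rfl⟩
    ∀ (r : LatticeRep G), ∃ (c A₀ β₃ : ℝ), 0 < c ∧
      ∀ (A : ℝ), A₀ ≤ A → ∀ (β : ℝ), β₃ ≤ β → ∀ (L : ℕ) [NeZero L], L ∈ 𝓛 → fl β ≤ L →
        ∀ Q : Finset (Literature.MathematicalPhysics.QuantumFieldTheory.Plaquette 4 L),
          wilsonMeasure (d := 4) (L := L) r.ρ β {U | ∀ p ∈ Q, A / (2 * β) < plaqCost r.ρ U p} ≤
            ENNReal.ofReal (Real.exp (-(c * A * Q.card)))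

/-- (R-on-𝓛) at the explicit floor (PROVED for `𝓛` = odd sides `≥ 3`). -/
def LargeFieldRarityOn (𝓛 : Set ℕ) : Prop := LargeFieldRarityOnFrom 𝓛 volFloor

/-- **(R-odd-tori) THE MAIN THEOREM AS A NAMED STATEMENT** (PROVED: `largeFieldRarityOddTori_holds`), in the crux's
parametrisation `𝕋⁴_{2S+1}`, `S ≥ 1`: for every compact simple `G` and lattice representation `r` there are `c > 0`, `A₀`, `β₃`
with `μ_{2S+1,β}{∀ p ∈ Q, s_p > A/(2β)} ≤ e^{−cA·#Q}` for all `A ≥ A₀`, `β ≥ β₃`, `2S+1 ≥ volFloor β = (⌈β⌉₊+2)²`, all `Q`. -/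
def LargeFieldRarityOddTori : Prop :=
  ∀ (G : Type) [Group G] [TopologicalSpace G] [IsTopologicalGroup G] [CompactSpace G],
    IsCompactSimpleLieGroup G →
    letI : MeasurableSpace G := borel G
    haveI : BorelSpace G := ⟨rfl⟩
    ∀ (r : LatticeRep G), ∃ (c A₀ β₃ : ℝ), 0 < c ∧
      ∀ A : ℝ, A₀ ≤ A → ∀ β : ℝ, β₃ ≤ β → ∀ S : ℕ, 1 ≤ S → volFloor β ≤ 2 * S + 1 →
        ∀ Q : Finset (Literature.MathematicalPhysics.QuantumFieldTheory.Plaquette 4 (2 * S + 1)),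
          wilsonMeasure (d := 4) (L := 2 * S + 1) r.ρ β {U | ∀ p ∈ Q, A / (2 * β) < plaqCost r.ρ U p} ≤
            ENNReal.ofReal (Real.exp (-(c * A * Q.card)))

/-- **(R♭) `LargeFieldRarityFrom` — VERBATIM the statement PROVED FIRST by the parallel seat ym-ir-idea-5 g6**
(`Cruxes/IR/Lines/largefield_rarity_uniform.lean`, `largeFieldRarityFrom_holds`, 2026-08-28T02:43Z; same lever: odd-torus
chessboard × the tree's Chatterjee theorem, volume floor `S₁(β)` NON-explicit from the thermodynamic limit at each `β`).  Recorded
so that both supplier files are seen to discharge ONE statement; implied by `LargeFieldRarityOddTori` (explicit floor, constants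
uniform in `A`) — `largeFieldRarityFrom_of_oddTori`. -/
def LargeFieldRarityFrom : Prop :=
  ∀ (G : Type) [Group G] [TopologicalSpace G] [IsTopologicalGroup G] [CompactSpace G],
    IsCompactSimpleLieGroup G →
    letI : MeasurableSpace G := borel G
    haveI : BorelSpace G := ⟨rfl⟩
    ∀ (r : LatticeRep G), ∃ A₀ : ℝ, ∀ A : ℝ, A₀ < A → ∃ (c β₃ : ℝ) (S₁ : ℝ → ℕ), 0 < c ∧ ∀ β : ℝ, β₃ ≤ β →
      ∀ (S : ℕ), S₁ β ≤ S → ∀ (Q : Finset (Literature.MathematicalPhysics.QuantumFieldTheory.Plaquette 4 (2 * S + 1))),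
        wilsonMeasure (d := 4) (L := 2 * S + 1) r.ρ β
            {U | ∀ p ∈ Q, A / (2 * β) < plaquetteCost r.ρ U p} ≤
          ENNReal.ofReal (Real.exp (-(c * A * Q.card)))

/-- **(FE<) FREE-ENERGY INCREMENT BELOW THE FLOOR** (OPEN, research M; the typed residual behind LINE 3's (R<)
`stub_largeFieldRaritySmallTori`): the increment bound of (FE) on the tori of side `1 ≤ L < volFloor β = (⌈β⌉₊+2)²`, uniformly.
Content: finite-torus Laplace asymptotics with an `O(L⁴)`-sharp Gaussian mode count — an UPPER bound `log Z_L(β') ≤ −ν_L log β' + K_L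
+ C L⁴` (Gaussian domination with the exact number `ν_L = νL⁴ + O(1)` of transverse modes, flat zero-modes ∕ torons contributing
`β⁰`; the research half) and a LOWER bound `log Z_L(β) ≥ −ν_L log β + K_L − C L⁴` (tree-gauge Gaussian ball, elementary:
`HaarSmallBallClosedSubgroup`-type); per-degree-of-freedom accuracy `O(1)` suffices, no smallness in `L/β`.  Cheapest falsifier:
`SU(2)`, `L = 3`, character expansion of `log Z_3(β) − log Z_3(β/2)` (idea-5 g6's proposal). -/
def FreeEnergyIncrementBelow : Prop :=
  ∀ (G : Type) [Group G] [TopologicalSpace G] [IsTopologicalGroup G] [CompactSpace G],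
    IsCompactSimpleLieGroup G →
    letI : MeasurableSpace G := borel G
    haveI : BorelSpace G := ⟨rfl⟩
    ∀ (r : LatticeRep G), ∃ (ν₀ C β₃ : ℝ), 0 < β₃ ∧
      ∀ (L : ℕ) [NeZero L] (β' β : ℝ), β₃ ≤ β' → β' ≤ β → L < volFloor β →
        torusLogPartition 4 r.ρ β' L - torusLogPartition 4 r.ρ β L ≤
          ν₀ * (L : ℝ) ^ 4 * Real.log (β / β') + C * (L : ℝ) ^ 4

/-- **LINE 3's (R) as re-typed in rev 3** (`SmallFieldPolymerCoder.LargeFieldRarity`, VERBATIM up to namespace): ALL odd tori `≥ 3`,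
no volume floor, one rate for `A ≥ A₀`. -/
def LargeFieldRarityAllOddTori : Prop :=
  ∀ (G : Type) [Group G] [TopologicalSpace G] [IsTopologicalGroup G] [CompactSpace G],
    IsCompactSimpleLieGroup G →
    letI : MeasurableSpace G := borel G
    haveI : BorelSpace G := ⟨rfl⟩
    ∀ (r : LatticeRep G), ∃ (c A₀ β₃ : ℝ), 0 < c ∧
      ∀ A : ℝ, A₀ ≤ A → ∀ β : ℝ, β₃ ≤ β → ∀ S : ℕ, 1 ≤ S →
        ∀ Q : Finset (Literature.MathematicalPhysics.QuantumFieldTheory.Plaquette 4 (2 * S + 1)),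
          wilsonMeasure (d := 4) (L := 2 * S + 1) r.ρ β {U | ∀ p ∈ Q, A / (2 * β) < plaqCost r.ρ U p} ≤
            ENNReal.ofReal (Real.exp (-(c * A * Q.card)))

/-- **LINE 3's (R<)** (`SmallFieldPolymerCoder.LargeFieldRaritySmallTori`, VERBATIM up to namespace): the small odd tori only. -/
def LargeFieldRaritySmallTori : Prop :=
  ∀ (G : Type) [Group G] [TopologicalSpace G] [IsTopologicalGroup G] [CompactSpace G],
    IsCompactSimpleLieGroup G →
    letI : MeasurableSpace G := borel G
    haveI : BorelSpace G := ⟨rfl⟩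
    ∀ (r : LatticeRep G), ∃ (c A₀ β₃ : ℝ), 0 < c ∧
      ∀ A : ℝ, A₀ ≤ A → ∀ β : ℝ, β₃ ≤ β → ∀ S : ℕ, 1 ≤ S → 2 * S + 1 < volFloor β →
        ∀ Q : Finset (Literature.MathematicalPhysics.QuantumFieldTheory.Plaquette 4 (2 * S + 1)),
          wilsonMeasure (d := 4) (L := 2 * S + 1) r.ρ β {U | ∀ p ∈ Q, A / (2 * β) < plaqCost r.ρ U p} ≤
            ENNReal.ofReal (Real.exp (-(c * A * Q.card)))

end Summit.QuantumFields.YangMills.Cruxes.IR.LargeFieldRarityChessboard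

end
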